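import Summits.HodgeConjecture.HodgeCM.Model.WeilCentralCoinvariants_1
import HarnessLib

/-!
# Twisted coinvariants along a SEMILINEAR intertwiner (Track T, (T4c) abstract half) — HC_CM is NOT proved

`HodgeCM.TwistedCoinv` (`HodgeCM/Model/WeilCentralCoinvariants_1.lean` §1b) has the functoriality of the
`χ`-coinvariants `Coinv ρW χ = S ⧸ span {ρW h v − χ h • v}` along `ℂ`-LINEAR maps `T : S → S'` for ONE group `H`
(`map`, `mapEquiv`, pointwise scalar twists).  Track T of the re-key plan (own-crow PROPOSAL T; mc-theta-3's ω-side spec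
(T4a)–(T4d), `HOME/INBOX` 2026-08-23T22:19:25Z) needs the CONJUGATE-LINEAR case with a CHANGE OF GROUP: complex
conjugation `C_f` on `𝒮((𝔸_F^∞)^{NM})` intertwines the finite Weil representation of the line `W_a` with that of the
mirror line `W_{−a}` (✔ `Weil1964.AdelicMetaplecticFinRepConj`, (T4b)) along the identification `U(J_W) = U(−J_W)`,
and carries the character `χ` to `χ̄`.  This file is the abstract descent step, for an arbitrary ring endomorphism pair
`σ, σ'` (`RingHomInvPair`), any map of groups `η : H → H'`, and commuting pairs `(ρV, ρW)`, `(ρV', ρW')`: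

* `ker_le_comap_semilinear`: a `σ`-semilinear `T : S →ₛₗ[σ] S'` with `T (ρW h v) = ρW' (η h) (T v)` and
  `χ' (η h) = σ (χ h)` carries the relation submodule of `(ρW, χ)` into that of `(ρW', χ')`;
* `mapₛₗ : Coinv ρW χ →ₛₗ[σ] Coinv ρW' χ'` (the descent, `mapₛₗ (mk v) = mk (T v)`), `mapₛₗ_rep` (it intertwines the
  `G`-actions `rep χ ρV` and `rep χ' ρV'` when `T (ρV g v) = ρV' g (T v)`), `mapₛₗ_surjective`;
* `mapEquivₛₗ : Coinv ρW χ ≃ₛₗ[σ] Coinv ρW' χ'` along a semilinear EQUIVALENCE `T` and a bijection `η`, with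
  `mapEquivₛₗ_mk`, `mapEquivₛₗ_symm_mk`, `mapEquivₛₗ_rep`.

Pure linear algebra; nothing here mentions Weil representations, CM types or orientation.  HELD; HC_CM is NOT proved.
References: Y. Liu, *Camb. J. Math.* 9 (2021), App. D, proof of Lemma D.1 Step 3 (the coinvariant model of `ω(μ, ε, χ)`),
Lemma D.1 (2) («`ω(μ,ε,χ)^∨ ≅ ω(μᶜ,−ε,χ⁻¹)`», the statement this descent serves).
-/

namespace HodgeCM.TwistedCoinv

variable {k : Type*} [CommRing k] {σ σ' : k →+* k}
variable {G H H' S S' : Type*} [Group G] [Group H] [Group H'] [AddCommGroup S] [Module k S]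
  [AddCommGroup S'] [Module k S']
variable (ρW : Representation k H S) (χ : H →* kˣ) (ρW' : Representation k H' S') (χ' : H' →* kˣ)

/-- **A semilinear intertwiner carries relations to relations**: if `T : S →ₛₗ[σ] S'` satisfies
`T (ρW h v) = ρW' (η h) (T v)` and `χ' (η h) = σ (χ h)`, then `T (ρW h v − χ h • v) = ρW' (η h) (T v) − χ' (η h) • T v`, so
`ker ρW χ ≤ comap T (ker ρW' χ')`. [cite: Liu2021, App. D proof of Lemma D.1 Step 3] -/
theorem ker_le_comap_semilinear (T : S →ₛₗ[σ] S') (η : H → H')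
    (hT : ∀ (h : H) (v : S), T (ρW h v) = ρW' (η h) (T v)) (hχ : ∀ h : H, ((χ' (η h) : kˣ) : k) = σ (χ h)) :
    ker ρW χ ≤ (ker ρW' χ').comap T := by
  rw [ker, Submodule.span_le]
  rintro _ ⟨⟨h, v⟩, rfl⟩
  show T (ρW h v - ((χ h : kˣ) : k) • v) ∈ ker ρW' χ'
  rw [map_sub, LinearMap.map_smulₛₗ, hT, ← hχ]
  exact sub_mem_ker ρW' χ' (η h) (T v)

/-- **Semilinear functoriality of the `χ`-coinvariants (change of group allowed)**: the descent
`Coinv ρW χ →ₛₗ[σ] Coinv ρW' χ'` of a `σ`-semilinear intertwiner `T` over `η : H → H'` with `χ' ∘ η = σ ∘ χ`.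
[cite: Liu2021, App. D proof of Lemma D.1 Step 3] -/
def mapₛₗ (T : S →ₛₗ[σ] S') (η : H → H')
    (hT : ∀ (h : H) (v : S), T (ρW h v) = ρW' (η h) (T v)) (hχ : ∀ h : H, ((χ' (η h) : kˣ) : k) = σ (χ h)) :
    Coinv ρW χ →ₛₗ[σ] Coinv ρW' χ' :=
  (ker ρW χ).mapQ (ker ρW' χ') T (ker_le_comap_semilinear ρW χ ρW' χ' T η hT hχ)

/-- on generators: `mapₛₗ (mk v) = mk (T v)`. [cite: Liu2021, App. D proof of Lemma D.1 Step 3] -/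
@[simp] theorem mapₛₗ_mk (T : S →ₛₗ[σ] S') (η : H → H')
    (hT : ∀ (h : H) (v : S), T (ρW h v) = ρW' (η h) (T v)) (hχ : ∀ h : H, ((χ' (η h) : kˣ) : k) = σ (χ h)) (v : S) :
    mapₛₗ ρW χ ρW' χ' T η hT hχ (mk ρW χ v) = mk ρW' χ' (T v) :=
  rfl

/-- `mapₛₗ` is onto when `T` is. [cite: Liu2021, App. D proof of Lemma D.1 Step 3] -/
theorem mapₛₗ_surjective (T : S →ₛₗ[σ] S') (η : H → H')
    (hT : ∀ (h : H) (v : S), T (ρW h v) = ρW' (η h) (T v)) (hχ : ∀ h : H, ((χ' (η h) : kˣ) : k) = σ (χ h))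
    (hsurj : Function.Surjective T) : Function.Surjective (mapₛₗ ρW χ ρW' χ' T η hT hχ) := by
  intro y
  obtain ⟨w, rfl⟩ := mk_surjective ρW' χ' y
  obtain ⟨v, rfl⟩ := hsurj w
  exact ⟨mk ρW χ v, rfl⟩

/-- **Equivariance**: for commuting pairs `(ρV, ρW)` on `S` and `(ρV', ρW')` on `S'` (same group `G`), if
`T (ρV g v) = ρV' g (T v)` then `mapₛₗ (rep χ ρV g x) = rep χ' ρV' g (mapₛₗ x)` — the descent is a `σ`-semilinear
`G`-intertwiner of the coinvariant representations. [cite: Liu2021, App. D proof of Lemma D.1 Step 3] -/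
theorem mapₛₗ_rep (ρV : Representation k G S) (ρV' : Representation k G S')
    (hc : ∀ (g : G) (h : H), Commute (ρV g) (ρW h)) (hc' : ∀ (g : G) (h' : H'), Commute (ρV' g) (ρW' h'))
    (T : S →ₛₗ[σ] S') (η : H → H')
    (hT : ∀ (h : H) (v : S), T (ρW h v) = ρW' (η h) (T v)) (hχ : ∀ h : H, ((χ' (η h) : kˣ) : k) = σ (χ h))
    (hV : ∀ (g : G) (v : S), T (ρV g v) = ρV' g (T v)) (g : G) (x : Coinv ρW χ) :
    mapₛₗ ρW χ ρW' χ' T η hT hχ (rep χ ρV hc g x) = rep χ' ρV' hc' g (mapₛₗ ρW χ ρW' χ' T η hT hχ x) := by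
  obtain ⟨v, rfl⟩ := mk_surjective ρW χ x
  rw [rep_mk, mapₛₗ_mk, mapₛₗ_mk, rep_mk, hV]

section Equiv

variable [RingHomInvPair σ σ'] [RingHomInvPair σ' σ]

/-- the hypotheses of `mapₛₗ` for the inverse data `(T.symm, η.symm)`. [cite: Liu2021, App. D proof of Lemma D.1 Step 3] -/
theorem mapₛₗ_hyp_symm (T : S ≃ₛₗ[σ] S') (η : H ≃ H')
    (hT : ∀ (h : H) (v : S), T (ρW h v) = ρW' (η h) (T v)) (h' : H') (w : S') :
    T.symm (ρW' h' w) = ρW (η.symm h') (T.symm w) := by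
  apply T.injective
  rw [LinearEquiv.apply_symm_apply, hT, Equiv.apply_symm_apply, LinearEquiv.apply_symm_apply]

omit [RingHomInvPair σ' σ] in
/-- the character hypothesis for the inverse data. [cite: Liu2021, App. D proof of Lemma D.1 Step 3] -/
theorem mapₛₗ_hypχ_symm (η : H ≃ H') (hχ : ∀ h : H, ((χ' (η h) : kˣ) : k) = σ (χ h)) (h' : H') :
    ((χ (η.symm h') : kˣ) : k) = σ' (χ' h') := by
  have h1 := hχ (η.symm h')
  rw [Equiv.apply_symm_apply] at h1
  rw [h1, RingHomInvPair.comp_apply_eq]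

/-- **Semilinear functoriality along an equivalence**: `Coinv ρW χ ≃ₛₗ[σ] Coinv ρW' χ'` for a `σ`-semilinear
equivalence `T : S ≃ₛₗ[σ] S'` and a bijection `η : H ≃ H'` with `T (ρW h v) = ρW' (η h) (T v)`, `χ' ∘ η = σ ∘ χ`.
[cite: Liu2021, App. D proof of Lemma D.1 Step 3] -/
def mapEquivₛₗ (T : S ≃ₛₗ[σ] S') (η : H ≃ H')
    (hT : ∀ (h : H) (v : S), T (ρW h v) = ρW' (η h) (T v)) (hχ : ∀ h : H, ((χ' (η h) : kˣ) : k) = σ (χ h)) :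
    Coinv ρW χ ≃ₛₗ[σ] Coinv ρW' χ' :=
  LinearEquiv.ofLinear
    (mapₛₗ ρW χ ρW' χ' T.toLinearMap η hT hχ)
    (mapₛₗ ρW' χ' ρW χ T.symm.toLinearMap η.symm (mapₛₗ_hyp_symm ρW ρW' T η hT)
      (mapₛₗ_hypχ_symm χ χ' η hχ))
    (Submodule.linearMap_qext _ (LinearMap.ext fun w => by
      change mk ρW' χ' (T (T.symm w)) = mk ρW' χ' w
      rw [LinearEquiv.apply_symm_apply]))
    (Submodule.linearMap_qext _ (LinearMap.ext fun v => by
      change mk ρW χ (T.symm (T v)) = mk ρW χ v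
      rw [LinearEquiv.symm_apply_apply]))

/-- on generators. [cite: Liu2021, App. D proof of Lemma D.1 Step 3] -/
@[simp] theorem mapEquivₛₗ_mk (T : S ≃ₛₗ[σ] S') (η : H ≃ H')
    (hT : ∀ (h : H) (v : S), T (ρW h v) = ρW' (η h) (T v)) (hχ : ∀ h : H, ((χ' (η h) : kˣ) : k) = σ (χ h)) (v : S) :
    mapEquivₛₗ ρW χ ρW' χ' T η hT hχ (mk ρW χ v) = mk ρW' χ' (T v) :=
  rfl

/-- the inverse on generators. [cite: Liu2021, App. D proof of Lemma D.1 Step 3] -/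
@[simp] theorem mapEquivₛₗ_symm_mk (T : S ≃ₛₗ[σ] S') (η : H ≃ H')
    (hT : ∀ (h : H) (v : S), T (ρW h v) = ρW' (η h) (T v)) (hχ : ∀ h : H, ((χ' (η h) : kˣ) : k) = σ (χ h)) (w : S') :
    (mapEquivₛₗ ρW χ ρW' χ' T η hT hχ).symm (mk ρW' χ' w) = mk ρW χ (T.symm w) :=
  rfl

/-- as a semilinear map, `mapEquivₛₗ` is `mapₛₗ`. [cite: Liu2021, App. D proof of Lemma D.1 Step 3] -/
theorem mapEquivₛₗ_apply (T : S ≃ₛₗ[σ] S') (η : H ≃ H')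
    (hT : ∀ (h : H) (v : S), T (ρW h v) = ρW' (η h) (T v)) (hχ : ∀ h : H, ((χ' (η h) : kˣ) : k) = σ (χ h))
    (x : Coinv ρW χ) :
    mapEquivₛₗ ρW χ ρW' χ' T η hT hχ x = mapₛₗ ρW χ ρW' χ' T.toLinearMap η hT hχ x :=
  rfl

/-- **Equivariance of `mapEquivₛₗ`**: a `σ`-semilinear `G`-isomorphism of the coinvariant representations when
`T (ρV g v) = ρV' g (T v)`. [cite: Liu2021, App. D proof of Lemma D.1 Step 3; Liu2021, App. D Lemma D.1 (2)] -/
theorem mapEquivₛₗ_rep (ρV : Representation k G S) (ρV' : Representation k G S')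
    (hc : ∀ (g : G) (h : H), Commute (ρV g) (ρW h)) (hc' : ∀ (g : G) (h' : H'), Commute (ρV' g) (ρW' h'))
    (T : S ≃ₛₗ[σ] S') (η : H ≃ H')
    (hT : ∀ (h : H) (v : S), T (ρW h v) = ρW' (η h) (T v)) (hχ : ∀ h : H, ((χ' (η h) : kˣ) : k) = σ (χ h))
    (hV : ∀ (g : G) (v : S), T (ρV g v) = ρV' g (T v)) (g : G) (x : Coinv ρW χ) :
    mapEquivₛₗ ρW χ ρW' χ' T η hT hχ (rep χ ρV hc g x) =
      rep χ' ρV' hc' g (mapEquivₛₗ ρW χ ρW' χ' T η hT hχ x) :=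
  mapₛₗ_rep ρW χ ρW' χ' ρV ρV' hc hc' T.toLinearMap η hT hχ hV g x

end Equiv

end HodgeCM.TwistedCoinv
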